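import Literature.NumberTheory.Automorphic.BaseChangeStrongUnramified
import Literature.NumberTheory.Automorphic.BaseChangeStrongAllFinite
import Literature.NumberTheory.Automorphic.BaseChangeArchimedeanUnitaryReduction
import HarnessLib

/-!
# Arthur–Clozel strong lifting at the finite places: the degenerate rank `0`, Satake parameters of
# clean models, and the unconditional reduction of the named facts to the printed setting
# (clean cuspidal data, unitary central character on `A_G`)

Topic `Literature/NumberTheory/Automorphic`; a proof file (theorems only: no definition, no named
fact, no instance), written for the named facts `ArthurClozel1989_strongLifting_unramified`
(`BaseChangeStrongUnramified`) and `ArthurClozel1989_strongLifting_allFinite`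
(`BaseChangeStrongAllFinite`) — J. Arthur, L. Clozel, *Simple algebras, base change, and the advanced
theory of the trace formula*, Ann. of Math. Stud. 120 (1989), Ch. 3, Thm. 5.1 with Ch. 1 §6 — next to
`BaseChangeStrongUnramifiedRankOne` / `BaseChangeStrongAllFiniteRankOne` (`n = 1`, proved) and in
exact parallel with `BaseChangeArchimedeanUnitaryReduction` (the archimedean clause of Thm. 5.1).

**What is printed, and what the tree quantifies over.**  Arthur–Clozel state Thm. 5.1 for
"representations induced from cuspidal" (Ch. 3, Def. 4.1, p. 202–203: "there is a cuspidal *unitary*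
representation `σ` of `M(𝐀)` … `π` is then unitary irreducible"); in the cuspidal case `π`, `Π` are
irreducible spaces of cusp forms with **unitary** central character — in the Borel–Jacquet formalism
of the tree, *clean* data `π = W / ⊥` on which the split component `A_G = ℝ_{>0}` of the centre acts
by a unitary character `a ↦ a^{μ}`, `Re μ = 0` (Borel–Jacquet 1979, 4.6 and 5.7).  The tree's
renderings quantify over **every** cuspidal Borel–Jacquet datum `π = W / W'`, `Π` (`W'` arbitrary,
any central character).  This file PROVES, unconditionally, that the wider statements follow from
their cases in the printed setting, so that a future discharge may assume Arthur–Clozel's standing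
hypotheses; and it settles the degenerate edge `n = 0` of the quantifier `∀ n` outright.

* `AutomorphicRepData.hasSatakeParamAt_rank_zero`, `hasSatakeParamAt_rank_zero_iff`,
  `isUnramifiedAt_rank_zero` — on `GL_0(𝔸_K)` (the trivial group) every datum is unramified at
  every finite place with the empty Satake parameter;
  `ArthurClozel1989_strongLifting_unramified.rank_zero`, `ArthurClozel1989_strongLifting_allFinite.rank_zero`.
* `AutomorphicRepData.IsShiftRealisation.hasSatakeParamAt_clean` — **Satake parameters of `π` are
  Satake parameters of its clean model `π₀ = C / ⊥`** (converse of the tree's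
  `IsShiftRealisation.hasSatakeParamAt`): write a `K(𝔫)`-spherical Hecke eigenform `f ∈ W ∖ W'`
  modulo `W'` as `f = x + w`, `x ∈ M`, `N x ∈ C`, `w ∈ W'` (`M_C + W' = W`,
  `preimage_sup_W'_eq`); then `c = N x ∈ C ∖ 0` is `K(𝔫)`-fixed and a Hecke eigenvector with the
  same eigenvalues, because `r(u) x - x` and `T x - λ x` lie in `M ∩ W'` and have `N`-image in `C`,
  hence `N`-image `0` (`C ∩ N(M ∩ W') = 0`).  Whence `hasSatakeParamAt_iff`, `isUnramifiedAt_iff`.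
* `AutomorphicRepData.isUnramifiedAt_of_map_mulChar_detTwist_of_cpow` — unramifiedness is preserved
  by the twists `π ⊗ |det|_𝔸^s` (`HasSatakeParamAt.of_map_mulChar_detTwist_of_cpow`).
* **`ArthurClozel1989_strongLifting_unramified_of_clean_unitaryCentral`**,
  **`ArthurClozel1989_strongLifting_allFinite_of_clean_unitaryCentral`** — each named fact follows
  from its case of clean cuspidal data `π`, `Π` (`W' = ⊥`, `n ≥ 1`) with `A_G` acting on `π` by a
  unitary character.  Proof (Borel–Jacquet 1979, 5.7, "we may assume `π` unitary", run on BOTH sides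
  with ONE exponent, as in `BaseChangeArchimedeanUnitaryReduction`): `n = 0` is `rank_zero`; for
  `n ≥ 1` the semisimplicity of `A_G`-invariant cusp forms
  (`AutomorphicRepsGL.stable_cuspidal_eq_sSup_irreducible_holds`) gives clean models `π₀`, `Π₀`
  (`exists_isShiftRealisation_of_sSup_irreducible`) with the SAME Satake parameters as `π`, `Π` (both
  directions, above), `A_G` acting on `π₀` by `a^{μ}`; with `s = -Re μ / n[F:ℚ]` the twists
  `π₁ = π₀ ⊗ |det|_{𝔸_F}^s`, `Π₁ = Π₀ ⊗ |det|_{𝔸_E}^s` are clean, `π₁` is unitary on `A_G`, `Π₁` is a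
  weak lift of `π₁` (`IsWeakBaseChangeLiftAE.of_map_mulChar_detTwist_of_cpow`), the Satake parameters
  are multiplied by `q_v^{-s}`, `q_w^{-s}` and `(q_v^{-s} a)^{f(w|v)} = q_w^{-s} a^{f(w|v)}`
  (`q_w = q_v^{f(w|v)}`, i.e. `|x|_E = |N x|_F`: base change commutes with `⊗ |det|^s`,
  Arthur–Clozel, Ch. 1, Prop. 6.8 (ii); Ch. 3, proof of Thm. 3.1); the hypothesis for `π₁`, `Π₁`
  is then carried back along the twists and the clean models.

Nothing here assumes the facts, and no statement of the tree is modified; the discharges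
`…_holds` are not attempted (for `n ≥ 2` the printed proof is the twisted trace formula comparison,
Ch. 2 Thms. A–B and Ch. 3 (4.1), with the local base change of Ch. 1 §6 — see the module docstrings
of `BaseChangeStrongUnramified`, `BaseChangeStrongAllFinite`).

## References

* J. Arthur, L. Clozel, *Simple algebras, base change, and the advanced theory of the trace
  formula*, Ann. of Math. Stud. 120 (1989), Ch. 3: §1 (1.1), Def. 1.1–1.2, Def. 4.1 (p. 202–203),
  Thm. 5.1 (p. 212), proof of Thm. 3.1; Ch. 1, Prop. 6.8 (ii). [ArthurClozelAMS120]
* A. Borel, H. Jacquet, *Automorphic forms and automorphic representations*, Corvallis 1979, §4.6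
  and 5.7 ("we may assume `π` unitary"). [BorelJacquetCorvallis1979]
* J. R. Getz, H. Hahn, *An Introduction to Automorphic Representations*, GTM 300 (2024), Thm. 6.5.1,
  Cor. 9.1.2. [GetzHahn2024]
-/

open scoped MatrixGroups Matrix Classical NNReal

noncomputable section

namespace Literature.NumberTheory.Automorphic

/-! ### Rank `0`: every datum on `GL_0` is unramified everywhere, with empty Satake parameter -/

section RankZero

open _root_.NumberField IsDedekindDomain

variable {K : Type} [Field K] [NumberField K] {hcpt : isCompact_glFiniteIntegralLevel 0 K}

namespace AutomorphicRepData

/-- **On `GL_0(𝔸_K)` every Borel–Jacquet datum has the empty Satake parameter at every finite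
place**: `GL_0(𝔸_K)` is the trivial group, so every `φ ∈ W ∖ W'` is fixed by the level `K(1)`, and
the only Hecke operator at `v` that the definition constrains, `[K(1) t_{v,0} K(1)] = [K(1)]`, is
the identity, with prescribed eigenvalue `q_v^0 e_0(∅) = 1` (degenerate edge of Borel–Jacquet 1979,
4.6; Bump §3.3). [folklore] -/
theorem hasSatakeParamAt_rank_zero (π : AutomorphicRepData (AutomorphyDatum.gl 0 K hcpt))
    (v : HeightOneSpectrum (𝓞 K)) : π.HasSatakeParamAt v 0 := by
  classical
  haveI : Subsingleton (AdelicGroupData.gl 0 K).Adelic :=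
    ⟨fun a b => Units.ext (Subsingleton.elim _ _)⟩
  -- a uniformizer of `K_v`
  obtain ⟨p, hp⟩ := v.valuation_exists_uniformizer K
  have hp' : Valued.v ((p : K) : v.adicCompletion K) = WithZero.exp (-1 : ℤ) := by
    rw [HeightOneSpectrum.valuedAdicCompletion_eq_valuation', hp]
  have hp0 : ((p : K) : v.adicCompletion K) ≠ 0 := fun h0 => by
    rw [h0, map_zero] at hp'
    exact WithZero.coe_ne_zero hp'.symm
  -- a vector outside `W'`
  obtain ⟨φ, hφW, hφW'⟩ := Set.exists_of_ssubset π.lt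
  have hfix : ∀ u : (AdelicGroupData.gl 0 K).Adelic,
      rightTranslation (AdelicGroupData.gl 0 K) u φ = φ := fun u => by
    rw [Subsingleton.elim u 1, map_one, Module.End.one_apply]
  refine ⟨⊤, Units.mk0 _ hp0, ?_, ?_, hp', by simp, φ, hφW, hφW', fun u _ => hfix u,
    fun i hi => ?_⟩
  · exact fun h => top_ne_bot (h.trans Submodule.zero_eq_bot)  -- `⊤ ≠ 0`
  · rw [Ideal.dvd_iff_le, top_le_iff]
    exact v.isPrime.ne_top
  · obtain rfl : i = 0 := Nat.le_zero.1 hi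
    have h1 : heckeDiagAt 0 K v (Units.mk0 _ hp0) 0 = 1 := Subsingleton.elim _ _
    have hφfix : φ ∈ (rightTranslation (AdelicGroupData.gl 0 K)).fixedPoints
        (principalCongruenceLevel 0 K ⊤) :=
      ((rightTranslation (AdelicGroupData.gl 0 K)).mem_fixedPoints _ φ).2 fun u _ => hfix u
    have hT : heckeOperator (rightTranslation (AdelicGroupData.gl 0 K)) (principalCongruenceLevel 0 K ⊤)
        (heckeDiagAt 0 K v (Units.mk0 _ hp0) 0) φ = φ := by
      rw [h1]
      exact heckeOperator_one_apply _ _ hφfix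
    have he : (0 : Multiset ℂ).esymm 0 = 1 := by simp [Multiset.esymm]
    rw [hT, he, mul_one, zero_mul, pow_zero, one_smul, sub_self]
    exact zero_mem _

/-- **Satake parameters on `GL_0`**: a datum on `GL_0(𝔸_K)` has Satake parameter `α` at `v` iff
`α = ∅` (a Satake parameter has `n = 0` entries). [folklore] -/
theorem hasSatakeParamAt_rank_zero_iff (π : AutomorphicRepData (AutomorphyDatum.gl 0 K hcpt))
    (v : HeightOneSpectrum (𝓞 K)) (α : Multiset ℂ) : π.HasSatakeParamAt v α ↔ α = 0 :=
  ⟨fun h => Multiset.card_eq_zero.1 h.card_eq, fun h => h ▸ π.hasSatakeParamAt_rank_zero v⟩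

/-- **Every datum on `GL_0(𝔸_K)` is unramified at every finite place.** [folklore] -/
theorem isUnramifiedAt_rank_zero (π : AutomorphicRepData (AutomorphyDatum.gl 0 K hcpt))
    (v : HeightOneSpectrum (𝓞 K)) : π.IsUnramifiedAt v :=
  ⟨0, π.hasSatakeParamAt_rank_zero v⟩

end AutomorphicRepData

/-- **The rank-`0` instance of `ArthurClozel1989_strongLifting_unramified` holds outright**: on
`GL_0` every datum is unramified everywhere with the empty Satake parameter, whose `f`-th power is
empty (`hasSatakeParamAt_rank_zero_iff`) — with no hypothesis on `E/F` and no weak-lift hypothesis.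
This is only the degenerate edge of the quantifier `∀ n`; the content of Arthur–Clozel's Thm. 5.1 is
`n ≥ 1`. [cite: ArthurClozelAMS120, Ch. 3 Thm. 5.1 with §1 (1.1)] -/
theorem ArthurClozel1989_strongLifting_unramified.rank_zero
    (F E : Type) [Field F] [NumberField F] [Field E] [NumberField E] [Algebra F E]
    (hF : isCompact_glFiniteIntegralLevel 0 F) (hE : isCompact_glFiniteIntegralLevel 0 E)
    (π : CuspidalAutomorphicRepData 0 F hF) (P : CuspidalAutomorphicRepData 0 E hE) :
    IsUnramifiedBaseChangeLift π.1 P.1 ∧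
      ∀ v : HeightOneSpectrum (𝓞 F), Algebra.IsUnramifiedIn (𝓞 E) v.asIdeal →
        (∀ w : HeightOneSpectrum (𝓞 E), w.asIdeal.under (𝓞 F) = v.asIdeal → P.1.IsUnramifiedAt w) →
          π.1.IsUnramifiedAt v := by
  refine ⟨fun w v α _ _ hα => ?_, fun v _ _ => π.1.isUnramifiedAt_rank_zero v⟩
  rw [(π.1.hasSatakeParamAt_rank_zero_iff v α).1 hα, Multiset.map_zero]
  exact P.1.hasSatakeParamAt_rank_zero w

/-- **The rank-`0` instance of `ArthurClozel1989_strongLifting_allFinite` holds outright** (same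
degenerate reason). [cite: ArthurClozelAMS120, Ch. 3 Thm. 5.1 with §1 (1.1)] -/
theorem ArthurClozel1989_strongLifting_allFinite.rank_zero
    (F E : Type) [Field F] [NumberField F] [Field E] [NumberField E] [Algebra F E]
    (hF : isCompact_glFiniteIntegralLevel 0 F) (hE : isCompact_glFiniteIntegralLevel 0 E)
    (π : CuspidalAutomorphicRepData 0 F hF) (P : CuspidalAutomorphicRepData 0 E hE)
    (w : HeightOneSpectrum (𝓞 E)) (v : HeightOneSpectrum (𝓞 F)) (α : Multiset ℂ)
    (hα : π.1.HasSatakeParamAt v α) :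
    P.1.HasSatakeParamAt w (α.map (· ^ w.asIdeal.inertiaDeg (𝓞 F))) := by
  rw [(π.1.hasSatakeParamAt_rank_zero_iff v α).1 hα, Multiset.map_zero]
  exact P.1.hasSatakeParamAt_rank_zero w

end RankZero

/-! ### Satake parameters transfer TO the clean model -/

section Clean

open _root_.NumberField IsDedekindDomain

variable {n : ℕ} {K : Type} [Field K] [NumberField K] {hcpt : isCompact_glFiniteIntegralLevel n K}
  {π π₀ : AutomorphicRepData (AutomorphyDatum.gl n K hcpt)} {μ : ℂ} {j : ℕ}
  {M : Submodule ℂ ((AdelicGroupData.gl n K).Adelic → ℂ)}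

namespace AutomorphicRepData.IsShiftRealisation

/-- **Satake parameters of `π = W / W'` are Satake parameters of its clean model `π₀ = C / ⊥`**
(converse of `IsShiftRealisation.hasSatakeParamAt`; Borel–Jacquet 1979, 4.6: `C ≅ W / W'` as
`GL_n(𝔸_K^∞)`-modules, so the spherical lines at `v` and the action of the unramified Hecke algebra
on them correspond).  Proof: a `K(𝔫)`-spherical Hecke eigenform `f ∈ W ∖ W'` modulo `W'` is
`f = x + w` with `x ∈ M`, `N x ∈ C`, `w ∈ W'` (`M_C + W' = W`, `preimage_sup_W'_eq`); `c = N x ∈ C`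
is non-zero (else `x ∈ W'`), `K(𝔫)`-fixed and a Hecke eigenvector with the same eigenvalues, since
`r(u) x - x` and `T x - λ x` lie in `M ∩ W'` with `N`-image `r(u) c - c`, `T c - λ c ∈ C`, hence `0`
(`C ∩ N(M ∩ W') = 0`; `N` commutes with right translations and Hecke operators).
[cite: BorelJacquetCorvallis1979, §4.6 and 5.7] -/
theorem hasSatakeParamAt_clean (h : IsShiftRealisation π π₀ μ j M) {v : HeightOneSpectrum (𝓞 K)}
    {β : Multiset ℂ} (hβ : π.HasSatakeParamAt v β) : π₀.HasSatakeParamAt v β := by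
  classical
  obtain ⟨𝔫, ϖ, h𝔫, hv𝔫, hϖ, hcard, f, hfW, hfW', hfix, hHecke⟩ := hβ
  -- the preimage `M_C = {x ∈ M | N x ∈ C}` and `M_C + W' = W`
  let P : Submodule ℂ ((AdelicGroupData.gl n K).Adelic → ℂ) :=
    { carrier := {x | x ∈ M ∧ shiftPow hcpt μ j x ∈ π₀.W}
      add_mem' := fun {a b} ha hb => ⟨add_mem ha.1 hb.1, by
        rw [shiftPow_add_of_mem π.stable μ j (h.M_le ha.1) (h.M_le hb.1)]; exact add_mem ha.2 hb.2⟩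
      zero_mem' := ⟨zero_mem _, by rw [shiftPow_zero]; exact zero_mem _⟩
      smul_mem' := fun a x hx => ⟨Submodule.smul_mem _ a hx.1, by
        rw [shiftPow_smul]; exact Submodule.smul_mem _ a hx.2⟩ }
  have hP : ∀ x, x ∈ P ↔ x ∈ M ∧ shiftPow hcpt μ j x ∈ π₀.W := fun x => Iff.rfl
  have hf : f ∈ P ⊔ π.W' := by
    rw [h.preimage_sup_W'_eq hP]
    exact hfW
  obtain ⟨x, hx, w, hw, hsum⟩ := Submodule.mem_sup.1 hf
  -- levels and Hecke operators are finite-adelic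
  set Kn : Subgroup (AdelicGroupData.gl n K).Adelic := principalCongruenceLevel n K 𝔫 with hKn
  set ρ : Representation ℂ (AdelicGroupData.gl n K).Adelic ((AdelicGroupData.gl n K).Adelic → ℂ) :=
    rightTranslation (AdelicGroupData.gl n K) with hρ
  have hKn_fin : ∀ k ∈ Kn, k ∈ (AutomorphyDatum.gl n K hcpt).finiteAdelic := fun k hk =>
    ⟨GLn.sndHom n K k, GLn.ofFinite_sndHom_of_mem (principalCongruenceLevel_le n K 𝔫 hk)⟩
  refine ⟨𝔫, ϖ, h𝔫, hv𝔫, hϖ, hcard, shiftPow hcpt μ j x, hx.2, ?_, fun u hu => ?_, fun i hi => ?_⟩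
  · -- `c = N x ≠ 0`: else `x ∈ W'` and `f = x + w ∈ W'`
    rw [h.bot, Submodule.mem_bot]
    intro h0
    exact hfW' (hsum ▸ add_mem (h.ker_le x hx.1 h0) hw)
  · -- `K(𝔫)`-invariance of `c`
    have hux : ρ u x ∈ M := h.stableM.finite_stable u (hKn_fin u hu) hx.1
    have hdiff : ρ u x - x ∈ π.W' := by
      have e : ρ u x - x = -(ρ u w - w) := by
        have hf' : ρ u x + ρ u w = x + w := by rw [← map_add, hsum]; exact hfix u hu
        rw [neg_sub, sub_eq_iff_eq_add, sub_add_eq_add_sub, eq_sub_iff_add_eq, hf', add_comm]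
      rw [e]
      exact π.W'.neg_mem (sub_mem (π.stable'.finite_stable u (hKn_fin u hu) hw) hw)
    have hN : shiftPow hcpt μ j (ρ u x - x) = ρ u (shiftPow hcpt μ j x) - shiftPow hcpt μ j x := by
      rw [shiftPow_sub_of_mem π.stable μ j (h.M_le hux) (h.M_le hx.1), hρ, shiftPow_rightTranslation]
    have hC : shiftPow hcpt μ j (ρ u x - x) ∈ π₀.W := by
      rw [hN]
      exact sub_mem (π₀.stable.finite_stable u (hKn_fin u hu) hx.2) hx.2
    have h0 := h.eq_zero _ (sub_mem hux hx.1) hdiff hC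
    rw [hN] at h0
    exact sub_eq_zero.1 h0
  · -- Hecke congruences modulo `W'` become identities on `C`
    have ht : (heckeDiagAt n K v ϖ i : (AdelicGroupData.gl n K).Adelic) ∈
        (AutomorphyDatum.gl n K hcpt).finiteAdelic := by
      rw [heckeDiagAt_eq_ofLocal_glDiagonal]
      exact GLn.ofLocal_mem_range_ofFinite v _
    have hfin := finite_orbit_heckeDiagAt (n := n) h𝔫 hv𝔫 hϖ i
    set c : ℂ := (((Real.sqrt (v.residueCard : ℝ)) : ℝ) : ℂ) ^ (i * (n - i)) * β.esymm i with hc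
    have hTx : heckeOperator ρ Kn (heckeDiagAt n K v ϖ i) x ∈ M :=
      heckeOperator_apply_mem_of_isStableSubmodule h.stableM hKn_fin ht hfin hx.1
    have hyM : heckeOperator ρ Kn (heckeDiagAt n K v ϖ i) x - c • x ∈ M :=
      sub_mem hTx (Submodule.smul_mem _ _ hx.1)
    have hyW' : heckeOperator ρ Kn (heckeDiagAt n K v ϖ i) x - c • x ∈ π.W' := by
      have hTw : heckeOperator ρ Kn (heckeDiagAt n K v ϖ i) w ∈ π.W' :=
        heckeOperator_apply_mem_of_isStableSubmodule π.stable' hKn_fin ht hfin hw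
      have e : heckeOperator ρ Kn (heckeDiagAt n K v ϖ i) x - c • x =
          (heckeOperator ρ Kn (heckeDiagAt n K v ϖ i) f - c • f) -
            (heckeOperator ρ Kn (heckeDiagAt n K v ϖ i) w - c • w) := by
        rw [← hsum, map_add, smul_add]
        abel
      rw [e]
      exact sub_mem (hHecke i hi) (sub_mem hTw (Submodule.smul_mem _ _ hw))
    have hN : shiftPow hcpt μ j (heckeOperator ρ Kn (heckeDiagAt n K v ϖ i) x - c • x) =
        heckeOperator ρ Kn (heckeDiagAt n K v ϖ i) (shiftPow hcpt μ j x) - c • shiftPow hcpt μ j x := by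
      rw [shiftPow_sub_of_mem π.stable μ j (h.M_le hTx) (Submodule.smul_mem _ _ (h.M_le hx.1)),
        shiftPow_smul, shiftPow_apply, hρ,
        iterate_shiftLie_heckeOperator π.stable μ j hKn_fin ht hfin (h.M_le hx.1), ← shiftPow_apply]
    have hC : shiftPow hcpt μ j (heckeOperator ρ Kn (heckeDiagAt n K v ϖ i) x - c • x) ∈ π₀.W := by
      rw [hN]
      exact sub_mem (heckeOperator_apply_mem_of_isStableSubmodule π₀.stable hKn_fin ht hfin hx.2)
        (Submodule.smul_mem _ _ hx.2)
    have h0 := h.eq_zero _ hyM hyW' hC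
    rw [hN, hρ] at h0
    rw [h0]
    exact zero_mem _

/-- **`π` and its clean model have the same Satake parameters.** [cite: BorelJacquetCorvallis1979, §4.6 and 5.7] -/
theorem hasSatakeParamAt_iff (h : IsShiftRealisation π π₀ μ j M) {v : HeightOneSpectrum (𝓞 K)}
    {β : Multiset ℂ} : π.HasSatakeParamAt v β ↔ π₀.HasSatakeParamAt v β :=
  ⟨h.hasSatakeParamAt_clean, h.hasSatakeParamAt⟩

/-- **`π` and its clean model are unramified at the same finite places.**
[cite: BorelJacquetCorvallis1979, §4.6 and 5.7] -/
theorem isUnramifiedAt_iff (h : IsShiftRealisation π π₀ μ j M) {v : HeightOneSpectrum (𝓞 K)} :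
    π.IsUnramifiedAt v ↔ π₀.IsUnramifiedAt v :=
  exists_congr fun _ => h.hasSatakeParamAt_iff

end AutomorphicRepData.IsShiftRealisation

end Clean

/-! ### Unramifiedness and the relation (1.1) under the norm twists `⊗ |det|^s` -/

section Twist

open _root_.NumberField IsDedekindDomain
open Literature.NumberTheory.GaloisRepresentations (HeckeCharacter ideleGroup)

variable {n : ℕ} {K : Type} [Field K] [NumberField K] {hcpt : isCompact_glFiniteIntegralLevel n K}

/-- `‖·‖^{s}⁻¹ = ‖·‖^{-s}` for the norm-power Hecke characters. [folklore] -/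
private theorem inv_apply_eq_ideleNorm_cpow_neg {χ : HeckeCharacter K} {s : ℂ}
    (hχ : ∀ x : ideleGroup K, ((χ x : ℂˣ) : ℂ) = (GaloisRepresentations.ideleNorm x : ℂ) ^ s)
    (x : ideleGroup K) :
    ((χ⁻¹ x : ℂˣ) : ℂ) = (GaloisRepresentations.ideleNorm x : ℂ) ^ (-s) := by
  rw [GaloisRepresentations.HeckeCharacter.inv_apply, Units.val_inv_eq_inv_val, hχ, Complex.cpow_neg]

/-- **`π ⊗ |det|_𝔸^s` is unramified where `π` is** (its Satake parameter there is `q_v^{-s} t_{π,v}`,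
`HasSatakeParamAt.of_map_mulChar_detTwist_of_cpow`). Borel–Jacquet 1979, 5.7.
[cite: BorelJacquetCorvallis1979, 5.7] -/
theorem AutomorphicRepData.isUnramifiedAt_of_map_mulChar_detTwist_of_cpow {χ : HeckeCharacter K}
    {s : ℂ} (hχ : ∀ x : ideleGroup K, ((χ x : ℂˣ) : ℂ) = (GaloisRepresentations.ideleNorm x : ℂ) ^ s)
    {π π' : AutomorphicRepData (AutomorphyDatum.gl n K hcpt)}
    (hW : π'.W = π.W.map (mulChar (detTwist n χ))) (hW' : π'.W' = π.W'.map (mulChar (detTwist n χ)))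
    {v : HeightOneSpectrum (𝓞 K)} (h : π.IsUnramifiedAt v) : π'.IsUnramifiedAt v := by
  obtain ⟨α, hα⟩ := h
  exact ⟨_, hα.of_map_mulChar_detTwist_of_cpow hχ hW hW'⟩

/-- **`π ⊗ |det|_𝔸^s` and `π` are unramified at the same places** (`π = (π ⊗ |det|^s) ⊗ |det|^{-s}`).
[cite: BorelJacquetCorvallis1979, 5.7] -/
theorem AutomorphicRepData.isUnramifiedAt_iff_of_map_mulChar_detTwist_of_cpow {χ : HeckeCharacter K}
    {s : ℂ} (hχ : ∀ x : ideleGroup K, ((χ x : ℂˣ) : ℂ) = (GaloisRepresentations.ideleNorm x : ℂ) ^ s)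
    {π π' : AutomorphicRepData (AutomorphyDatum.gl n K hcpt)}
    (hW : π'.W = π.W.map (mulChar (detTwist n χ))) (hW' : π'.W' = π.W'.map (mulChar (detTwist n χ)))
    {v : HeightOneSpectrum (𝓞 K)} : π'.IsUnramifiedAt v ↔ π.IsUnramifiedAt v := by
  refine ⟨fun h => ?_, AutomorphicRepData.isUnramifiedAt_of_map_mulChar_detTwist_of_cpow hχ hW hW'⟩
  have hWs : π.W = π'.W.map (mulChar (detTwist n χ⁻¹)) := by
    rw [hW, detTwist_inv, map_mulChar_inv_map_mulChar]
  have hW's : π.W' = π'.W'.map (mulChar (detTwist n χ⁻¹)) := by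
    rw [hW', detTwist_inv, map_mulChar_inv_map_mulChar]
  exact AutomorphicRepData.isUnramifiedAt_of_map_mulChar_detTwist_of_cpow
    (inv_apply_eq_ideleNorm_cpow_neg hχ) hWs hW's h

/-- `q_w = q_v^{f(w|v)}` for finite places `w ∣ v` of `E ⊇ F` (Mathlib `Ideal.inertiaDeg_eq_of_isMaximal`
and `Module.natCard_eq_pow_finrank`; a copy of the private lemma of `BaseChangeArchimedeanUnitaryReduction`,
repeated to keep this file independent of `ArtinFormalismInductionProofs`). [folklore] -/
private theorem residueCard_eq_pow_inertiaDeg_of_under_eq' {F E : Type} [Field F] [Field E]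
    [Algebra F E] [NumberField F] [NumberField E]
    {v : HeightOneSpectrum (𝓞 F)} {w : HeightOneSpectrum (𝓞 E)} (hw : w.asIdeal.under (𝓞 F) = v.asIdeal) :
    w.residueCard = v.residueCard ^ w.asIdeal.inertiaDeg (𝓞 F) := by
  rw [HeightOneSpectrum.residueCard_eq_card_quotient, HeightOneSpectrum.residueCard_eq_card_quotient]
  haveI : w.asIdeal.IsMaximal := w.isMaximal
  haveI : v.asIdeal.IsMaximal := v.isMaximal
  haveI : w.asIdeal.LiesOver v.asIdeal := ⟨hw.symm⟩
  letI : Field (𝓞 F ⧸ v.asIdeal) := Ideal.Quotient.field _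
  rw [Ideal.inertiaDeg_eq_of_isMaximal v.asIdeal w.asIdeal,
    Module.natCard_eq_pow_finrank (K := 𝓞 F ⧸ v.asIdeal)]

/-- `((q ^ k : ℕ) : ℂ) ^ s = ((q : ℂ) ^ s) ^ k`. [folklore] -/
private theorem natCast_pow_cpow' (q k : ℕ) (s : ℂ) : ((q ^ k : ℕ) : ℂ) ^ s = ((q : ℂ) ^ s) ^ k := by
  induction k with
  | zero => simp
  | succ k ih => rw [pow_succ, Nat.cast_mul, Complex.natCast_mul_natCast_cpow, ih, pow_succ]

/-- **The relation (1.1) at one pair of places `w ∣ v` descends along the simultaneous twists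
`π₁ = π ⊗ |det|_{𝔸_F}^s`, `Π₁ = Π ⊗ |det|_{𝔸_E}^s`**: if every Satake parameter `α₁` of `π₁` at `v`
gives the parameter `α₁^{f(w|v)}` of `Π₁` at `w`, then every Satake parameter `α` of `π` at `v` gives
the parameter `α^{f(w|v)}` of `Π` at `w` — the parameters are `q_v^{-s} α` and `q_w^{-s} α^{f}`, and
`(q_v^{-s} a)^{f(w|v)} = q_w^{-s} a^{f(w|v)}` because `q_w = q_v^{f(w|v)}` (`|x|_E = |N x|_F`: base
change commutes with `⊗ |det|^s`; Arthur–Clozel, Ch. 1, Prop. 6.8 (ii) and Ch. 3, proof of Thm. 3.1).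
[cite: ArthurClozelAMS120, Ch. 1 Prop. 6.8 (ii); Ch. 3, proof of Thm. 3.1] -/
theorem AutomorphicRepData.hasSatakeParamAt_pow_of_map_mulChar_detTwist_of_cpow
    {F E : Type} [Field F] [NumberField F] [Field E] [NumberField E] [Algebra F E]
    {hF : isCompact_glFiniteIntegralLevel n F} {hE : isCompact_glFiniteIntegralLevel n E} {s : ℂ}
    {χF : HeckeCharacter F}
    (hχF : ∀ x : ideleGroup F, ((χF x : ℂˣ) : ℂ) = (GaloisRepresentations.ideleNorm x : ℂ) ^ s)
    {χE : HeckeCharacter E}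
    (hχE : ∀ x : ideleGroup E, ((χE x : ℂˣ) : ℂ) = (GaloisRepresentations.ideleNorm x : ℂ) ^ s)
    {π π₁ : AutomorphicRepData (AutomorphyDatum.gl n F hF)}
    {P P₁ : AutomorphicRepData (AutomorphyDatum.gl n E hE)}
    (hW : π₁.W = π.W.map (mulChar (detTwist n χF))) (hW' : π₁.W' = π.W'.map (mulChar (detTwist n χF)))
    (hV : P₁.W = P.W.map (mulChar (detTwist n χE))) (hV' : P₁.W' = P.W'.map (mulChar (detTwist n χE)))
    {w : HeightOneSpectrum (𝓞 E)} {v : HeightOneSpectrum (𝓞 F)} (hwv : w.asIdeal.under (𝓞 F) = v.asIdeal)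
    (h₁ : ∀ α₁ : Multiset ℂ, π₁.HasSatakeParamAt v α₁ →
      P₁.HasSatakeParamAt w (α₁.map (· ^ w.asIdeal.inertiaDeg (𝓞 F))))
    {α : Multiset ℂ} (hα : π.HasSatakeParamAt v α) :
    P.HasSatakeParamAt w (α.map (· ^ w.asIdeal.inertiaDeg (𝓞 F))) := by
  -- `Π = Π₁ ⊗ |det|^{-s}`
  have hVs : P.W = P₁.W.map (mulChar (detTwist n χE⁻¹)) := by
    rw [hV, detTwist_inv, map_mulChar_inv_map_mulChar]
  have hV's : P.W' = P₁.W'.map (mulChar (detTwist n χE⁻¹)) := by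
    rw [hV', detTwist_inv, map_mulChar_inv_map_mulChar]
  -- twist to `π₁`, apply the relation, untwist to `Π`
  have hα₁ := AutomorphicRepData.HasSatakeParamAt.of_map_mulChar_detTwist_of_cpow hχF hW hW' hα
  have hβ := AutomorphicRepData.HasSatakeParamAt.of_map_mulChar_detTwist_of_cpow
    (inv_apply_eq_ideleNorm_cpow_neg hχE) hVs hV's (h₁ _ hα₁)
  -- the parameters agree: `q_w^{s} (q_v^{-s} a)^f = a^f`
  have hq : (v.residueCard : ℂ) ≠ 0 :=
    Nat.cast_ne_zero.2 (by have := v.one_lt_residueCard; omega)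
  convert hβ using 1
  rw [Multiset.map_map, Multiset.map_map]
  refine Multiset.map_congr rfl fun a _ => ?_
  simp only [Function.comp_apply]
  rw [neg_neg, mul_pow, residueCard_eq_pow_inertiaDeg_of_under_eq' hwv, natCast_pow_cpow', ← mul_assoc,
    ← mul_pow, Complex.cpow_neg, mul_inv_cancel₀ (fun h0 => hq ((Complex.cpow_eq_zero_iff _ _).1 h0).1),
    one_pow, one_mul]

end Twist

/-! ### Reduction of the facts to clean cuspidal data with unitary central character on `A_G` -/

section Reduction

open _root_.NumberField IsDedekindDomain Filter
open Literature.NumberTheory.GaloisRepresentations (HeckeCharacter ideleGroup)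

/-- `A_G` acts on `|det|_𝔸^s · φ` by `a ↦ a^{ν}`, `ν = n[K:ℚ] s + μ`, when it acts on `φ` by `a ↦ a^μ`
(`detTwist_posRealScalar_of_cpow`; the statement of `BaseChangeArchimedeanUnitaryReduction`, whose
copy there is private). Borel–Jacquet 1979, 5.7. [cite: BorelJacquetCorvallis1979, 5.7] -/
private theorem mulChar_detTwist_apply_posRealScalar_mul_of_cpow_of_eq' {n : ℕ} {K : Type} [Field K]
    [NumberField K] {χ : HeckeCharacter K} {s : ℂ}
    (hχ : ∀ x : ideleGroup K, ((χ x : ℂˣ) : ℂ) = (GaloisRepresentations.ideleNorm x : ℂ) ^ s)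
    {μ ν : ℂ} (hν : ((n * Module.finrank ℚ K : ℕ) : ℂ) * s + μ = ν)
    {φ : (AdelicGroupData.gl n K).Adelic → ℂ}
    (hφ : ∀ (t : ℝ≥0ˣ) (g : (AdelicGroupData.gl n K).Adelic),
      φ ((show (AdelicGroupData.gl n K).Adelic from posRealScalar n K t) * g) =
        (((t : ℝ≥0) : ℝ) : ℂ) ^ μ * φ g)
    (t : ℝ≥0ˣ) (g : (AdelicGroupData.gl n K).Adelic) :
    mulChar (detTwist n χ) φ ((show (AdelicGroupData.gl n K).Adelic from posRealScalar n K t) * g) =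
      (((t : ℝ≥0) : ℝ) : ℂ) ^ ν * mulChar (detTwist n χ) φ g := by
  subst hν
  have ht : (0 : ℝ) < ((t : ℝ≥0) : ℝ) := NNReal.coe_pos.2 (pos_iff_ne_zero.2 t.ne_zero)
  have ht' : (((t : ℝ≥0) : ℝ) : ℂ) ≠ 0 := Complex.ofReal_ne_zero.2 ht.ne'
  rw [mulChar_apply, mulChar_apply, map_mul, Units.val_mul, hφ t g]
  change ((detTwist n χ (posRealScalar n K t) : ℂˣ) : ℂ) * _ * _ = _
  rw [detTwist_posRealScalar_of_cpow hχ, ← Real.rpow_natCast, ← Complex.cpow_mul_ofReal_nonneg ht.le,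
    Complex.cpow_add _ _ ht', Complex.ofReal_natCast]
  ring

/-- **The common reduction step** (Borel–Jacquet 1979, 5.7, "we may assume `π` unitary", run on both
sides with one exponent): for cuspidal `π` on `GL_n(𝔸_F)` and `Π` on `GL_n(𝔸_E)`, `n ≥ 1`, with `Π` a
weak base change lift of `π`, there are CLEAN cuspidal data `π₁`, `Π₁` (`W' = ⊥`), `π₁` with unitary
central character on `A_G`, `Π₁` a weak lift of `π₁`, such that `π₁`, `π` resp. `Π₁`, `Π` are
unramified at the same places and the relation (1.1) at any pair `w ∣ v` for `(π₁, Π₁)` implies it for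
`(π, Π)`.  Construction: clean models `π₀`, `Π₀` (`exists_isShiftRealisation_of_sSup_irreducible`,
granted `AutomorphicRepsGL.stable_cuspidal_eq_sSup_irreducible_holds`), then the simultaneous twists by
`|det|_{𝔸_F}^s`, `|det|_{𝔸_E}^s`, `s = -Re μ / n[F:ℚ]`.
[cite: BorelJacquetCorvallis1979, 5.7] [cite: ArthurClozelAMS120, Ch. 3, Def. 4.1 and proof of Thm. 3.1] -/
theorem CuspidalAutomorphicRepData.exists_clean_unitaryCentral_weakLift {n : ℕ} [NeZero n] {F E : Type}
    [Field F] [NumberField F] [Field E] [NumberField E] [Algebra F E]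
    {hF : isCompact_glFiniteIntegralLevel n F} {hE : isCompact_glFiniteIntegralLevel n E}
    (π : CuspidalAutomorphicRepData n F hF) (P : CuspidalAutomorphicRepData n E hE)
    (hBC : IsWeakBaseChangeLiftAE π.1 P.1) :
    ∃ (π₁ : CuspidalAutomorphicRepData n F hF) (P₁ : CuspidalAutomorphicRepData n E hE),
      π₁.1.W' = ⊥ ∧ P₁.1.W' = ⊥ ∧
      (∃ μ : ℂ, μ.re = 0 ∧ ∀ φ ∈ π₁.1.W, ∀ (t : ℝ≥0ˣ) (g : (AdelicGroupData.gl n F).Adelic),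
        φ ((show (AdelicGroupData.gl n F).Adelic from posRealScalar n F t) * g) =
          (((t : ℝ≥0) : ℝ) : ℂ) ^ μ * φ g) ∧
      IsWeakBaseChangeLiftAE π₁.1 P₁.1 ∧
      (∀ v : HeightOneSpectrum (𝓞 F), π₁.1.IsUnramifiedAt v ↔ π.1.IsUnramifiedAt v) ∧
      (∀ w : HeightOneSpectrum (𝓞 E), P₁.1.IsUnramifiedAt w ↔ P.1.IsUnramifiedAt w) ∧
      ∀ (w : HeightOneSpectrum (𝓞 E)) (v : HeightOneSpectrum (𝓞 F)), w.asIdeal.under (𝓞 F) = v.asIdeal →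
        (∀ α₁ : Multiset ℂ, π₁.1.HasSatakeParamAt v α₁ →
          P₁.1.HasSatakeParamAt w (α₁.map (· ^ w.asIdeal.inertiaDeg (𝓞 F)))) →
        ∀ α : Multiset ℂ, π.1.HasSatakeParamAt v α →
          P.1.HasSatakeParamAt w (α.map (· ^ w.asIdeal.inertiaDeg (𝓞 F))) := by
  have hn : 0 < n := Nat.pos_of_ne_zero (NeZero.ne n)
  -- (1) clean models `π₀`, `Π₀` realising `π`, `Π`
  obtain ⟨π₀, μ, j, M, hπ⟩ :=
    π.exists_isShiftRealisation_of_sSup_irreducible AutomorphicRepsGL.stable_cuspidal_eq_sSup_irreducible_holds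
  obtain ⟨P₀, μ', j', M', hP⟩ :=
    P.exists_isShiftRealisation_of_sSup_irreducible AutomorphicRepsGL.stable_cuspidal_eq_sSup_irreducible_holds
  have hBC₀ : IsWeakBaseChangeLiftAE π₀.1 P₀.1 :=
    hBC.of_satakeTransfer (fun v β hβ => hπ.hasSatakeParamAt hβ) (fun w β hβ => hP.hasSatakeParamAt hβ)
  -- (2) the real exponent `s`, `n[F:ℚ] s = -Re μ`
  have hdF : ((n * Module.finrank ℚ F : ℕ) : ℝ) ≠ 0 := by
    exact_mod_cast mul_ne_zero hn.ne' Module.finrank_pos.ne'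
  set s : ℝ := -μ.re / ((n * Module.finrank ℚ F : ℕ) : ℝ) with hsdef
  have hs : ((n * Module.finrank ℚ F : ℕ) : ℝ) * s = -μ.re := by
    rw [hsdef, mul_div_cancel₀ _ hdF]
  have hνF : ((n * Module.finrank ℚ F : ℕ) : ℂ) * ((s : ℝ) : ℂ) + μ = ((μ.im : ℝ) : ℂ) * Complex.I := by
    have e : ((n * Module.finrank ℚ F : ℕ) : ℂ) * ((s : ℝ) : ℂ) = ((-μ.re : ℝ) : ℂ) := by
      rw [← hs]
      push_cast
      ring
    rw [e]
    apply Complex.ext <;> simp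
  -- (3) the simultaneous twists `π₁ = π₀ ⊗ |det|_F^s`, `Π₁ = Π₀ ⊗ |det|_E^s`
  obtain ⟨χF, hχF⟩ := exists_heckeCharacter_ideleNorm_cpow F ((s : ℝ) : ℂ)
  obtain ⟨χE, hχE⟩ := exists_heckeCharacter_ideleNorm_cpow E ((s : ℝ) : ℂ)
  obtain ⟨π₁, hW₁, hW₁'⟩ := exists_cuspidalAutomorphicRepData_map_mulChar_detTwist hχF π₀
  obtain ⟨P₁, hV₁, hV₁'⟩ := exists_cuspidalAutomorphicRepData_map_mulChar_detTwist hχE P₀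
  have hπ₁ : π₁.1.W' = ⊥ := by rw [hW₁', hπ.bot, Submodule.map_bot]
  have hP₁ : P₁.1.W' = ⊥ := by rw [hV₁', hP.bot, Submodule.map_bot]
  have hunitπ : ∃ ν : ℂ, ν.re = 0 ∧ ∀ φ ∈ π₁.1.W, ∀ (t : ℝ≥0ˣ) (g : (AdelicGroupData.gl n F).Adelic),
      φ ((show (AdelicGroupData.gl n F).Adelic from posRealScalar n F t) * g) =
        (((t : ℝ≥0) : ℝ) : ℂ) ^ ν * φ g := by
    refine ⟨((μ.im : ℝ) : ℂ) * Complex.I, by simp, fun φ hφ t g => ?_⟩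
    rw [hW₁] at hφ
    obtain ⟨φ₀, hφ₀, rfl⟩ := Submodule.mem_map.1 hφ
    exact mulChar_detTwist_apply_posRealScalar_mul_of_cpow_of_eq' hχF hνF
      (fun t g => hπ.apply_posRealScalar_mul hφ₀ t g) t g
  have hBC₁ : IsWeakBaseChangeLiftAE π₁.1 P₁.1 :=
    hBC₀.of_map_mulChar_detTwist_of_cpow hχF hχE hW₁ hW₁' hV₁ hV₁'
  refine ⟨π₁, P₁, hπ₁, hP₁, hunitπ, hBC₁, fun v => ?_, fun w => ?_, fun w v hwv h₁ α hα => ?_⟩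
  · rw [AutomorphicRepData.isUnramifiedAt_iff_of_map_mulChar_detTwist_of_cpow hχF hW₁ hW₁',
      hπ.isUnramifiedAt_iff]
  · rw [AutomorphicRepData.isUnramifiedAt_iff_of_map_mulChar_detTwist_of_cpow hχE hV₁ hV₁',
      hP.isUnramifiedAt_iff]
  · exact hP.hasSatakeParamAt
      (AutomorphicRepData.hasSatakeParamAt_pow_of_map_mulChar_detTwist_of_cpow hχF hχE hW₁ hW₁' hV₁ hV₁'
        hwv h₁ (hπ.hasSatakeParamAt_clean hα))

/-- **`ArthurClozel1989_strongLifting_unramified` follows from its case of clean cuspidal data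
`π`, `Π` with `π` of unitary central character on `A_G`** — Arthur–Clozel's own setting: Thm. 5.1 is
stated for representations induced from *unitary* cuspidal ones (Ch. 3, Def. 4.1, "cuspidal unitary
representation … `π` is then unitary irreducible"), and a clean (`W' = ⊥`, `n ≥ 1`) cuspidal
Borel–Jacquet datum on which the split component `A_G = ℝ_{>0}` of the centre acts by `a ↦ a^{μ}`,
`Re μ = 0`, is an irreducible `(𝔤, K_∞) × GL_n(𝔸^∞)`-stable space of cusp forms with unitary central
character (Borel–Jacquet 1979, 4.6, 5.7).  The hypothesis `H` is the fact verbatim on such data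
(same `E/F` Galois of prime degree, same weak-lift hypothesis, same two conclusions); the theorem
extends it to every cuspidal datum `π = W / W'`, `Π`, unconditionally: `n = 0` is
`ArthurClozel1989_strongLifting_unramified.rank_zero`; for `n ≥ 1`,
`exists_clean_unitaryCentral_weakLift` provides clean `π₁`, `Π₁` in the printed setting with the same
unramified places as `π`, `Π` and along which the relation (1.1) descends place by place.
Borel–Jacquet 1979, 5.7; Arthur–Clozel 1989, Ch. 3, Def. 4.1 and Thm. 5.1.
[cite: ArthurClozelAMS120, Ch. 3, Def. 4.1 and Thm. 5.1] [cite: BorelJacquetCorvallis1979, 5.7] -/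
theorem ArthurClozel1989_strongLifting_unramified_of_clean_unitaryCentral
    (H : ∀ (n : ℕ) (F E : Type) [Field F] [NumberField F] [Field E] [NumberField E] [Algebra F E]
      [IsGalois F E] (hF : isCompact_glFiniteIntegralLevel n F)
      (hE : isCompact_glFiniteIntegralLevel n E), (Module.finrank F E).Prime → 0 < n →
        ∀ (π : CuspidalAutomorphicRepData n F hF) (P : CuspidalAutomorphicRepData n E hE),
          π.1.W' = ⊥ → P.1.W' = ⊥ →
          (∃ μ : ℂ, μ.re = 0 ∧ ∀ φ ∈ π.1.W, ∀ (t : ℝ≥0ˣ) (g : (AdelicGroupData.gl n F).Adelic),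
            φ ((show (AdelicGroupData.gl n F).Adelic from posRealScalar n F t) * g) =
              (((t : ℝ≥0) : ℝ) : ℂ) ^ μ * φ g) →
          IsWeakBaseChangeLiftAE π.1 P.1 →
            IsUnramifiedBaseChangeLift π.1 P.1 ∧
              ∀ v : HeightOneSpectrum (𝓞 F), Algebra.IsUnramifiedIn (𝓞 E) v.asIdeal →
                (∀ w : HeightOneSpectrum (𝓞 E),
                    w.asIdeal.under (𝓞 F) = v.asIdeal → P.1.IsUnramifiedAt w) →
                  π.1.IsUnramifiedAt v) :
    ArthurClozel1989_strongLifting_unramified := by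
  intro n F E _ _ _ _ _ _ hprime hF hE π P hBC
  rcases Nat.eq_zero_or_pos n with hn | hn
  · subst hn
    exact ArthurClozel1989_strongLifting_unramified.rank_zero F E hF hE π P
  haveI : NeZero n := ⟨hn.ne'⟩
  obtain ⟨π₁, P₁, hπ₁, hP₁, hunit, hBC₁, hurπ, hurP, hrel⟩ := π.exists_clean_unitaryCentral_weakLift P hBC
  have h₁ := H n F E hF hE hprime hn π₁ P₁ hπ₁ hP₁ hunit hBC₁
  refine ⟨fun w v α hwv hv hα => hrel w v hwv (fun α₁ hα₁ => h₁.1 w v α₁ hwv hv hα₁) α hα,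
    fun v hv hPv => ?_⟩
  rw [← hurπ v]
  exact h₁.2 v hv fun w hw => (hurP w).2 (hPv w hw)

/-- **`ArthurClozel1989_strongLifting_allFinite` follows from its case of clean cuspidal data
`π`, `Π` with `π` of unitary central character on `A_G`** (same reduction, for the sibling fact:
the relation (1.1) at every finite `w ∣ v`, ramified `v` allowed).
[cite: ArthurClozelAMS120, Ch. 3, Def. 4.1 and Thm. 5.1] [cite: BorelJacquetCorvallis1979, 5.7] -/
theorem ArthurClozel1989_strongLifting_allFinite_of_clean_unitaryCentral
    (H : ∀ (n : ℕ) (F E : Type) [Field F] [NumberField F] [Field E] [NumberField E] [Algebra F E]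
      [IsGalois F E] (hF : isCompact_glFiniteIntegralLevel n F)
      (hE : isCompact_glFiniteIntegralLevel n E), (Module.finrank F E).Prime → 0 < n →
        ∀ (π : CuspidalAutomorphicRepData n F hF) (P : CuspidalAutomorphicRepData n E hE),
          π.1.W' = ⊥ → P.1.W' = ⊥ →
          (∃ μ : ℂ, μ.re = 0 ∧ ∀ φ ∈ π.1.W, ∀ (t : ℝ≥0ˣ) (g : (AdelicGroupData.gl n F).Adelic),
            φ ((show (AdelicGroupData.gl n F).Adelic from posRealScalar n F t) * g) =
              (((t : ℝ≥0) : ℝ) : ℂ) ^ μ * φ g) →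
          IsWeakBaseChangeLiftAE π.1 P.1 →
            ∀ (w : HeightOneSpectrum (𝓞 E)) (v : HeightOneSpectrum (𝓞 F)) (α : Multiset ℂ),
              w.asIdeal.under (𝓞 F) = v.asIdeal → π.1.HasSatakeParamAt v α →
                P.1.HasSatakeParamAt w (α.map (· ^ w.asIdeal.inertiaDeg (𝓞 F)))) :
    ArthurClozel1989_strongLifting_allFinite := by
  intro n F E _ _ _ _ _ _ hprime hF hE π P hBC w v α hwv hα
  rcases Nat.eq_zero_or_pos n with hn | hn
  · subst hn
    exact ArthurClozel1989_strongLifting_allFinite.rank_zero F E hF hE π P w v α hα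
  haveI : NeZero n := ⟨hn.ne'⟩
  obtain ⟨π₁, P₁, hπ₁, hP₁, hunit, hBC₁, -, -, hrel⟩ := π.exists_clean_unitaryCentral_weakLift P hBC
  have h₁ := H n F E hF hE hprime hn π₁ P₁ hπ₁ hP₁ hunit hBC₁
  exact hrel w v hwv (fun α₁ hα₁ => h₁ w v α₁ hwv hα₁) α hα

end Reduction

end Literature.NumberTheory.Automorphic

end
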